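import Mathlib.RingTheory.Flat.FaithfullyFlat.Algebra
import Mathlib.RingTheory.RegularLocalRing.Defs
import Mathlib.RingTheory.LocalRing.ResidueField.Defs
import HarnessLib

/-!
# Crux `FrobeniusLadder.FRationalResolution` (stmt-ResolutionOfSingularities-15317), line `redirect`,
# stub `stub_diagonalizableQuotientResolution` — a local ring with a faithfully flat algebra that is a
# FIELD is itself a field (descent step for Kato's condition (2.1)(i) along the inseparable
# `D(B_p)`-torsor `Spec S^{(B)} → Spec S₀` at a non-fixed point; remaining item R3 of the census)

At a non-fixed prime the quotient `Spec S₀` is reached from the Kato-log-regular intermediate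
quotient `Spec S^{(B_𝔔)}` (`…EveryPointLogRegular`) by a `D(B_𝔔)`-torsor: étale for the prime-to-`p`
part (an étale log chart, no descent), and for the `p`-part a finite FREE local extension
`R = (S₀)_𝔮 → T`. With the unit-twisted monomial chart `ψ(m) = x^m λ(m)` into `S₀`, Kato's ideal
satisfies `I_ψ T = I_x T = 𝔪_T`, so `R/I_ψ → T/I_ψ T = κ(T)` is faithfully flat onto a field; this
file supplies the conclusion `R/I_ψ` is a field (hence regular), i.e. Kato (2.1)(i) for `Spec S₀`:

* `isField_of_faithfullyFlat` — if `B` is a faithfully flat `A`-algebra and `B` is a field then `A`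
  is a field (`I B ∩ A = I` for every ideal, Mathlib `Ideal.comap_map_eq_self_of_faithfullyFlat`);
* `isRegularLocalRing_of_faithfullyFlat_of_isField` — and therefore a regular local ring.

Honest label: generic algebra brick for R3 (no stub closed). No definitions, no named facts, no sorry.
[folklore; cite: Matsumura1987, Thm. 7.5]
-/

-- single-problem summit: the doubled namespace component is forced
set_option linter.dupNamespace false

namespace Summit.ResolutionOfSingularities.ResolutionOfSingularities.Theorems.FRationalResolution.FaithfullyFlatFieldDescent

universe u v

/-- **Fields descend along faithfully flat maps**: if `B` is a faithfully flat `A`-algebra and a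
field, then `A` is a field. (`A → B` is injective, so `A` is a nontrivial commutative ring; for
`a ≠ 0` the ideal `aA` extends to `aB = B`, and `aB ∩ A = aA` by faithful flatness, so `a` is a
unit.) [cite: Matsumura1987, Thm. 7.5] -/
theorem isField_of_faithfullyFlat (A : Type u) (B : Type v) [CommRing A] [CommRing B]
    [Algebra A B] [Module.FaithfullyFlat A B] (hB : IsField B) : IsField A := by
  letI := hB.toField
  haveI : Nontrivial A := by
    by_contra htriv
    rw [not_nontrivial_iff_subsingleton] at htriv
    have h01 : (0 : B) = 1 := by
      rw [← map_zero (algebraMap A B), ← map_one (algebraMap A B), Subsingleton.elim (0 : A) 1]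
    exact zero_ne_one h01
  have hinj : Function.Injective (algebraMap A B) := FaithfulSMul.algebraMap_injective A B
  refine ⟨exists_pair_ne A, mul_comm, fun {a} ha => ?_⟩
  have hunit : IsUnit (algebraMap A B a) := (IsUnit.mk0 _ ((map_ne_zero_iff _ hinj).mpr ha))
  have htop : (Ideal.span {a}).map (algebraMap A B) = ⊤ := by
    rw [Ideal.map_span, Set.image_singleton, Ideal.span_singleton_eq_top]
    exact hunit
  have hA : Ideal.span {a} = ⊤ := by
    rw [← Ideal.comap_map_eq_self_of_faithfullyFlat (B := B) (Ideal.span {a}), htop, Ideal.comap_top]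
  obtain ⟨b, hb⟩ := Ideal.mem_span_singleton'.mp ((Ideal.eq_top_iff_one _).mp hA)
  exact ⟨b, by rw [mul_comm]; exact hb⟩

/-- A ring with a faithfully flat algebra that is a field is a REGULAR LOCAL ring (a field).
[folklore; cite: Matsumura1987, Thm. 7.5] -/
theorem isRegularLocalRing_of_faithfullyFlat_of_isField (A : Type u) (B : Type v) [CommRing A]
    [CommRing B] [Algebra A B] [Module.FaithfullyFlat A B] (hB : IsField B) :
    IsRegularLocalRing A := by
  letI := (isField_of_faithfullyFlat A B hB).toField
  infer_instance

end Summit.ResolutionOfSingularities.ResolutionOfSingularities.Theorems.FRationalResolution.FaithfullyFlatFieldDescent
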